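import Summits.QuantumFields.BalabanUV.Beta.D1BFx.GramWeightColourLift

/-!
# `BalabanUV.Beta.D1BFx.ColourLiftPackedHess` — road «BF-x» for binder row D1, slot (K), X₃(ii) ROUTE T, brick **K-TA4C** PART 3 — THE
# `hessT` READ-OUT OF THE STRIPPED IDENTITY: TA4's packed-corner reading (`MixedVarPackedHess.mixedVar_kkt_fromRows_zero`) for the SIGNED
# first jets `tj = [[k, −[q;0]ᵀ],[[q;0], 0]]` (zero comb rows and columns, packed corner `tj₂ = [[k, −qᵀ],[q, 0]]`), and the colour-stripped
# Gram-form identity in `hessT` currency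

HONEST DEPENDENCY (cell records, verbatim): «continuum YM on T⁴ ⇐ BetaPertH ∧ nine spine estimates (0/9 proved); BetaPertH ⇐ (D1) ∧ (D4) ∧
CAP+tail; G-an2-4 gates asym, D1 and NE2/3/4.»  HONEST FRAMING (cell contract, verbatim): «discharging `BetaPertH` makes Bałaban's UV stability
UNCONDITIONAL — a real constructive-QFT result; it is NOT the continuum limit and NOT the Clay problem.»  THIS MODULE DISCHARGES NOTHING of (K),
of D1 or of the wall: [folklore] finite linear algebra over TA4 `MixedVarPackedHess` (`hessT`, `two_mul_hessT`, `trace_mul_kkt_fromRows_zero`,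
`trace_eq_trace_submatrix_of_comb_col_zero`, `submatrix_mul_of_comb_col_zero`, `mixedVar_eq_two_mul_hessT`) and K-TA4C PART 2
`GramWeightColourLift` (`tj`, `tj₂`, `mixedVar_gramTransfer_stripped`), BY NAME.  No definition, no `def … : Prop`, nothing cited, no wall
binder instantiated, 0 sorry.  NOT D1, NOT BetaPertH, NOT continuum, NOT Clay.

ABSOLUTE RULE (cell charter, verbatim): «No internally-minted statement may enter as a cited fact. Every hypothesis is either kernel-proved in this
package or a verbatim quotation of a PUBLISHED theorem with page reference. The manuscript(s) under audit are NOT citable for their own disputed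
steps — they are the thing under adjudication; programme-internal (2001/route/tribunal) claims are never citable.»
Provenance: G-an2-4 formalisation swarm leaf seat `b2b-balaban-gan24-formalise-leaf-03` gen 44 (cross-lane), claim «K-TA4C» PART 3, 2026-08-20.
-/

noncomputable section

namespace Summit.QuantumFields.BalabanUV.Beta.D1BFx.ColourLiftPackedHess

open Matrix
open Literature.MathematicalPhysics.QuantumFieldTheory.Balaban1983to89.Beta.Composition (kkt)
open Summit.QuantumFields.BalabanUV.Beta.D1BFx.SliceTransferJetsMixed (mixedVar)
open Summit.QuantumFields.BalabanUV.Beta.D1BFx.MixedVarPackedHess (hessT two_mul_hessT trace_mul_kkt_fromRows_zero trace_eq_trace_submatrix_of_comb_col_zero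
  submatrix_mul_of_comb_col_zero mixedVar_eq_two_mul_hessT sum_three_eq_sum_map_add)
open Summit.QuantumFields.BalabanUV.Beta.D1BFx.GramWeightJets (gram₀)
open Summit.QuantumFields.BalabanUV.Beta.D1BFx.GramWeightColourLift (tj tj₂ tgram₁ tgramMix mixedVar_gramTransfer_stripped)

/-! ## §1 The signed jet has zero comb rows∕columns and packed corner `tj₂` -/

section Pack

variable {ν μ ρ : Type*}

/-- [folklore] The packed corner of `tj` is `tj₂`. -/
theorem tj_apply_map (k : Matrix ν ν ℝ) (q : Matrix μ ν ℝ) (i j : ν ⊕ μ) :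
    tj ρ k q (Sum.map id Sum.inl i) (Sum.map id Sum.inl j) = tj₂ k q i j := by
  rcases i with i | i <;> rcases j with j | j <;> rfl

/-- [folklore] `tj` has ZERO comb columns. -/
theorem tj_apply_inr_inr_right (k : Matrix ν ν ℝ) (q : Matrix μ ν ℝ) (a : ν ⊕ (μ ⊕ ρ)) (r : ρ) :
    tj ρ k q a (Sum.inr (Sum.inr r)) = 0 := by
  rcases a with a | a | a
  · simp [tj, Matrix.fromBlocks, Matrix.fromRows]
  · rfl
  · rfl

/-- [folklore] `tj` has ZERO comb rows. -/
theorem tj_apply_inr_inr_left (k : Matrix ν ν ℝ) (q : Matrix μ ν ℝ) (r : ρ) (b : ν ⊕ (μ ⊕ ρ)) :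
    tj ρ k q (Sum.inr (Sum.inr r)) b = 0 := by
  rcases b with b | b | b <;> rfl

end Pack

/-! ## §2 Only the packed blocks of the leg meet the signed jets -/

section Meet

variable {ν μ ρ : Type*} [Fintype ν] [Fintype μ] [Fintype ρ]

/-- [folklore] `(X · tj).submatrix f e = X.submatrix f e · tj₂`. -/
theorem submatrix_mul_tj {l : Type*} (X : Matrix (ν ⊕ (μ ⊕ ρ)) (ν ⊕ (μ ⊕ ρ)) ℝ) (k : Matrix ν ν ℝ) (q : Matrix μ ν ℝ) (f : l → ν ⊕ (μ ⊕ ρ)) :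
    (X * tj ρ k q).submatrix f (Sum.map id Sum.inl) = X.submatrix f (Sum.map id Sum.inl) * tj₂ k q := by
  ext a j
  simp only [Matrix.submatrix_apply, Matrix.mul_apply]
  rw [sum_three_eq_sum_map_add]
  simp only [tj_apply_map, tj_apply_inr_inr_left, mul_zero, Finset.sum_const_zero, add_zero]

/-- [folklore] The comb columns of `X · tj` vanish. -/
theorem mul_tj_apply_inr_inr (X : Matrix (ν ⊕ (μ ⊕ ρ)) (ν ⊕ (μ ⊕ ρ)) ℝ) (k : Matrix ν ν ℝ) (q : Matrix μ ν ℝ) (a : ν ⊕ (μ ⊕ ρ)) (r : ρ) :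
    (X * tj ρ k q) a (Sum.inr (Sum.inr r)) = 0 := by
  simp only [Matrix.mul_apply, tj_apply_inr_inr_right, mul_zero, Finset.sum_const_zero]

/-- [folklore] **SIGNED BUBBLE READ-OUT**: `tr(X·tjₛ·(Y·tjₜ)) = tr(X.submatrix e e·tj₂ₛ·(Y.submatrix e e·tj₂ₜ))`. -/
theorem trace_mul_tj_mul_mul_tj (X Y : Matrix (ν ⊕ (μ ⊕ ρ)) (ν ⊕ (μ ⊕ ρ)) ℝ) (kₛ kₜ : Matrix ν ν ℝ) (qₛ qₜ : Matrix μ ν ℝ) :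
    (X * tj ρ kₛ qₛ * (Y * tj ρ kₜ qₜ)).trace =
      (X.submatrix (Sum.map id Sum.inl) (Sum.map id Sum.inl) * tj₂ kₛ qₛ *
        (Y.submatrix (Sum.map id Sum.inl) (Sum.map id Sum.inl) * tj₂ kₜ qₜ)).trace := by
  have h₂ : ∀ a r, (X * tj ρ kₛ qₛ * (Y * tj ρ kₜ qₜ)) a (Sum.inr (Sum.inr r)) = 0 := by
    intro a r
    simp only [Matrix.mul_apply (M := X * tj ρ kₛ qₛ), mul_tj_apply_inr_inr Y kₜ qₜ, mul_zero, Finset.sum_const_zero]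
  rw [trace_eq_trace_submatrix_of_comb_col_zero h₂, submatrix_mul_of_comb_col_zero (mul_tj_apply_inr_inr X kₛ qₛ), submatrix_mul_tj,
    submatrix_mul_tj]

end Meet

/-! ## §3 `mixedVar` with signed first jets = `2·hessT` of the packed leg; the stripped identity in `hessT` currency -/

section Main

variable {ν μ ρ : Type*} [Fintype ν] [Fintype μ] [Fintype ρ] [DecidableEq ν] [DecidableEq μ] [DecidableEq ρ]

/-- [folklore] **TA4 FOR SIGNED FIRST JETS**: `mixedVar M (tj kₛ qₛ) (tj kₜ qₜ) (kkt kₛₜ [qₛₜ;0]) = 2·hessT (M⁻¹.submatrix e e) (tj₂ kₛ qₛ) (tj₂ kₜ qₜ) (kkt kₛₜ qₛₜ)`. -/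
theorem mixedVar_tj (M : Matrix (ν ⊕ (μ ⊕ ρ)) (ν ⊕ (μ ⊕ ρ)) ℝ) (kₛ kₜ kₛₜ : Matrix ν ν ℝ) (qₛ qₜ qₛₜ : Matrix μ ν ℝ) :
    mixedVar M (tj ρ kₛ qₛ) (tj ρ kₜ qₜ) (kkt kₛₜ (fromRows qₛₜ (0 : Matrix ρ ν ℝ)))
      = 2 * hessT (M⁻¹.submatrix (Sum.map id Sum.inl) (Sum.map id Sum.inl)) (tj₂ kₛ qₛ) (tj₂ kₜ qₜ) (kkt kₛₜ qₛₜ) := by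
  rw [two_mul_hessT, mixedVar, trace_mul_kkt_fromRows_zero, trace_mul_tj_mul_mul_tj]

/-- [folklore] **K-TA4C IN `hessT` CURRENCY — the colour-stripped Gram-form jet identity**, for COLOURLESS typed data satisfying ONLY the one-sided
letters (hypotheses verbatim those of `GramWeightColourLift.mixedVar_gramTransfer_stripped`):
`hessT (M⁻¹|; tj₂ kₛ qₛ, tj₂ kₜ qₜ, kkt kₛₜ qₛₜ) + hessT (Φ₀⁻¹; tgram₁ …, tgram₁ …, tgramMix …) = hessT (N₀⁻¹; tj₂ (kₛ + b̃ₛ) qₛ, tj₂ (kₜ + b̃ₜ) qₜ,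
kkt (kₛₜ + b̃ₛₜ) qₛₜ) + 2·hessT ((τW₀)⁻¹; τwₛ, τwₜ, τwₛₜ)`. -/
theorem hessT_gramTransfer_stripped
    (K₀ kₛ kₜ kₛₛ kₜₜ kₛₜ : Matrix ν ν ℝ) (Q₀ qₛ qₜ qₛₛ qₜₜ qₛₜ : Matrix μ ν ℝ)
    (T₀ tₛ tₜ tₛₛ tₜₜ tₛₜ : Matrix ρ ν ℝ) (A₀ Aₛ Aₜ Aₛₛ Aₜₜ Aₛₜ : Matrix ρ ρ ℝ) (W₀ wₛ wₜ wₛₛ wₜₜ wₛₜ : Matrix ν ρ ℝ) (τ : Matrix ρ ν ℝ)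
    (hK₀ : K₀ᵀ = K₀) (hkₛ : kₛᵀ = -kₛ) (hkₜ : kₜᵀ = -kₜ) (hkₛₛ : kₛₛᵀ = kₛₛ) (hkₜₜ : kₜₜᵀ = kₜₜ) (hkₛₜ : kₛₜᵀ = kₛₜ)
    (a0 : K₀ * W₀ = 0) (aₛ : kₛ * W₀ + K₀ * wₛ = 0) (aₜ : kₜ * W₀ + K₀ * wₜ = 0)
    (aₛₛ : kₛₛ * W₀ + (2 : ℝ) • (kₛ * wₛ) + K₀ * wₛₛ = 0) (aₜₜ : kₜₜ * W₀ + (2 : ℝ) • (kₜ * wₜ) + K₀ * wₜₜ = 0)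
    (aₛₜ : kₛₜ * W₀ + kₛ * wₜ + kₜ * wₛ + K₀ * wₛₜ = 0)
    (b0 : Q₀ * W₀ = 0) (bₛ : qₛ * W₀ + Q₀ * wₛ = 0) (bₜ : qₜ * W₀ + Q₀ * wₜ = 0)
    (bₛₛ : qₛₛ * W₀ + (2 : ℝ) • (qₛ * wₛ) + Q₀ * wₛₛ = 0) (bₜₜ : qₜₜ * W₀ + (2 : ℝ) • (qₜ * wₜ) + Q₀ * wₜₜ = 0)
    (bₛₜ : qₛₜ * W₀ + qₛ * wₜ + qₜ * wₛ + Q₀ * wₛₜ = 0)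
    (hτ : (τ * W₀).det ≠ 0) (hT : (T₀ * W₀).det ≠ 0) (hA : A₀.det ≠ 0) (hM : (kkt K₀ (fromRows Q₀ τ)).det ≠ 0) :
    hessT ((kkt K₀ (fromRows Q₀ τ))⁻¹.submatrix (Sum.map id Sum.inl) (Sum.map id Sum.inl)) (tj₂ kₛ qₛ) (tj₂ kₜ qₜ) (kkt kₛₜ qₛₜ)
      + hessT (gram₀ W₀ (gram₀ T₀ A₀))⁻¹ (tgram₁ W₀ wₛ (gram₀ T₀ A₀) (tgram₁ T₀ tₛ A₀ Aₛ)) (tgram₁ W₀ wₜ (gram₀ T₀ A₀) (tgram₁ T₀ tₜ A₀ Aₜ))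
          (tgramMix W₀ wₛ wₜ wₛₜ (gram₀ T₀ A₀) (tgram₁ T₀ tₛ A₀ Aₛ) (tgram₁ T₀ tₜ A₀ Aₜ) (tgramMix T₀ tₛ tₜ tₛₜ A₀ Aₛ Aₜ Aₛₜ))
    = hessT (kkt (K₀ + gram₀ T₀ A₀) Q₀)⁻¹ (tj₂ (kₛ + tgram₁ T₀ tₛ A₀ Aₛ) qₛ) (tj₂ (kₜ + tgram₁ T₀ tₜ A₀ Aₜ) qₜ)
          (kkt (kₛₜ + tgramMix T₀ tₛ tₜ tₛₜ A₀ Aₛ Aₜ Aₛₜ) qₛₜ)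
      + 2 * hessT (τ * W₀)⁻¹ (τ * wₛ) (τ * wₜ) (τ * wₛₜ) := by
  have h := mixedVar_gramTransfer_stripped K₀ kₛ kₜ kₛₛ kₜₜ kₛₜ Q₀ qₛ qₜ qₛₛ qₜₜ qₛₜ T₀ tₛ tₜ tₛₛ tₜₜ tₛₜ A₀ Aₛ Aₜ Aₛₛ Aₜₜ Aₛₜ
    W₀ wₛ wₜ wₛₛ wₜₜ wₛₜ τ hK₀ hkₛ hkₜ hkₛₛ hkₜₜ hkₛₜ a0 aₛ aₜ aₛₛ aₜₜ aₛₜ b0 bₛ bₜ bₛₛ bₜₜ bₛₜ hτ hT hA hM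
  rw [mixedVar_tj, mixedVar_eq_two_mul_hessT (gram₀ W₀ (gram₀ T₀ A₀)), mixedVar_eq_two_mul_hessT (kkt (K₀ + gram₀ T₀ A₀) Q₀),
    mixedVar_eq_two_mul_hessT (τ * W₀)] at h
  linarith

end Main

/-! ## §4 (v1.1) The `D`-placement dictionary of F-g6-1: `hessT (D·L; j·D, j′·D, w·D) = hessT (L; j, j′, w)` for an involution `D` -/

section Placement

variable {ι : Type*} [Fintype ι] [DecidableEq ι]

/-- [folklore] **THE PLACEMENT LEMMA** (owner F-g6-1: «leg `G = D·L`, first-order tables `V = j·D`, second-order `W = w·D`, and the `D`'s cancel»):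
for any involution `D` (`D·D = 1`), `hessT (D * L) (j * D) (j′ * D) (w * D) = hessT L j j′ w`. -/
theorem hessT_placement {D : Matrix ι ι ℝ} (hD : D * D = 1) (L j j' w : Matrix ι ι ℝ) :
    hessT (D * L) (j * D) (j' * D) (w * D) = hessT L j j' w := by
  unfold hessT
  have h1 : (D * L * (w * D)).trace = (L * w).trace := by
    rw [Matrix.trace_mul_comm, ← Matrix.mul_assoc, Matrix.mul_assoc w D D, hD, Matrix.mul_one, Matrix.trace_mul_comm]
  have h2 : (D * L * (j * D) * (D * L * (j' * D))).trace = (L * j * (L * j')).trace := by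
    have e : D * L * (j * D) * (D * L * (j' * D)) = D * (L * j * (L * j')) * D := by
      calc D * L * (j * D) * (D * L * (j' * D)) = D * (L * j) * (D * D) * (L * j') * D := by simp only [Matrix.mul_assoc]
        _ = D * (L * j * (L * j')) * D := by rw [hD, Matrix.mul_one]; simp only [Matrix.mul_assoc]
    rw [e, Matrix.trace_mul_comm, ← Matrix.mul_assoc, hD, Matrix.one_mul]
  rw [h1, h2]

variable {ν μ : Type*} [Fintype ν] [Fintype μ] [DecidableEq ν] [DecidableEq μ]

/-- [folklore] The signed bordered first jet IS the placed `kkt`: `tj₂ k q = kkt k q · diag(1, −1)`. -/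
theorem tj₂_eq_kkt_mul_sgn (k : Matrix ν ν ℝ) (q : Matrix μ ν ℝ) :
    tj₂ k q = kkt k q * Matrix.fromBlocks (1 : Matrix ν ν ℝ) 0 0 (-1 : Matrix μ μ ℝ) := by
  rw [tj₂, kkt, Matrix.fromBlocks_multiply]
  simp

/-- [folklore] `diag(1, −1)` is an involution. -/
theorem sgn_mul_sgn : Matrix.fromBlocks (1 : Matrix ν ν ℝ) 0 0 (-1 : Matrix μ μ ℝ) * Matrix.fromBlocks (1 : Matrix ν ν ℝ) 0 0 (-1 : Matrix μ μ ℝ) = 1 := by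
  rw [Matrix.fromBlocks_multiply]
  simp [Matrix.fromBlocks_one]

end Placement


end Summit.QuantumFields.BalabanUV.Beta.D1BFx.ColourLiftPackedHess

end
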